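import Literature.AnabelianGeometry.SemiGraphs.TemperedSpecialFibreAdmissibleKernel
import HarnessLib

/-!
# [SemiAnbd] Cor. 3.11, step (S1): the descended isomorphism is FUNCTORIAL in `γ` (proof-only)

Mochizuki, *Semi-graphs of anabelioids*, Publ. RIMS **42** (2006), §3, Corollary 3.11, manuscript p. 46 =
PRIMS p. 271 [cite: MochizukiSemiAnbd2006, Cor 3.11 p.46]: "any isomorphism of topological groups
`γ : Δ[α] ⥲ Δ[β]` determines a compatible isomorphism … in a fashion that is functorial with respect to `γ`",
and proof p. 49 = PRIMS p. 275 "[which is, of course, functorial in `γ`]".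

For the descent `SpecialFibreData.descend` of `γ` along the admissible quotients
(`TemperedSpecialFibreAdmissibleKernel.lean`) this file PROVES the functoriality print asserts, at the
level of the tempered fundamental groups of the special fibres: kernel compatibility
(`SpecialFibreData.KernelCompatible`) is reflexive, symmetric and transitive, and the descended isomorphisms
compose accordingly — `descend (refl) = refl`, `descend (γ₁ ≫ γ₂) = descend γ₁ ≫ descend γ₂`,
`descend γ⁻¹ = (descend γ)⁻¹`; and the automorphism of `π₁^temp(G^c)` induced by conjugation by `g ∈ Π`
(`SpecialFibreData.autOfConj`, `TemperedSpecialFibreDataVertexAction.lean`) IS the descent of the inner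
automorphism `conjDelta g` of `Δ` (consistency of the two constructions).  Proof-only; no statement of the
frozen files is altered; nothing here takes a side on [IUTchIII] Cor. 3.12 and nothing asserts or refutes abc.
-/

noncomputable section

namespace Literature.AnabelianGeometry.SemiGraphs

open ProfiniteSemiGraph Topology

universe u

namespace SpecialFibreData

variable {Kα : Type u} [Field Kα] {Kβ : Type u} [Field Kβ] {Kγ : Type u} [Field Kγ]
  {Dα : TemperedArithmeticGroup Kα} {Dβ : TemperedArithmeticGroup Kβ} {Dγ : TemperedArithmeticGroup Kγ}
  {Sα : SpecialFibreData Dα} {Sβ : SpecialFibreData Dβ} {Sγ : SpecialFibreData Dγ}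

/-! ### Kernel compatibility is an equivalence relation on isomorphisms -/

/-- The identity of `Δ` is kernel compatible. [cite: MochizukiSemiAnbd2006, Cor 3.11 p.46] -/
theorem KernelCompatible.refl {K : Type u} [Field K] {D : TemperedArithmeticGroup K} (S : SpecialFibreData D) :
    S.KernelCompatible S (ContinuousMulEquiv.refl _) :=
  fun _ => Iff.rfl

/-- Kernel compatibility is transitive along composition `γ₁ ≫ γ₂`.
[cite: MochizukiSemiAnbd2006, Cor 3.11 p.46] -/
theorem KernelCompatible.trans {γ₁ : Dα.delta ≃ₜ* Dβ.delta} {γ₂ : Dβ.delta ≃ₜ* Dγ.delta}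
    (h₁ : Sα.KernelCompatible Sβ γ₁) (h₂ : Sβ.KernelCompatible Sγ γ₂) :
    Sα.KernelCompatible Sγ (γ₁.trans γ₂) :=
  fun x => (h₁ x).trans (h₂ (γ₁ x))

/-! ### Functoriality of the descent -/

/-- **`descend (id) = id`.** [cite: MochizukiSemiAnbd2006, Cor 3.11 p.46] -/
theorem descend_refl {K : Type u} [Field K] {D : TemperedArithmeticGroup K} (S : SpecialFibreData D) :
    S.descend S (ContinuousMulEquiv.refl _) (KernelCompatible.refl S) = ContinuousMulEquiv.refl _ := by
  apply ContinuousMulEquiv.ext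
  intro y
  obtain ⟨x, rfl⟩ := S.admissible_surjective y
  rw [descend_admissible]
  rfl

/-- **`descend (γ₁ ≫ γ₂) = descend γ₁ ≫ descend γ₂`** — the descended isomorphism is functorial in `γ`
(print: "in a fashion that is functorial with respect to `γ`"). [cite: MochizukiSemiAnbd2006, Cor 3.11 p.46] -/
theorem descend_trans {γ₁ : Dα.delta ≃ₜ* Dβ.delta} {γ₂ : Dβ.delta ≃ₜ* Dγ.delta}
    (h₁ : Sα.KernelCompatible Sβ γ₁) (h₂ : Sβ.KernelCompatible Sγ γ₂) :
    Sα.descend Sγ (γ₁.trans γ₂) (h₁.trans h₂) = (Sα.descend Sβ γ₁ h₁).trans (Sβ.descend Sγ γ₂ h₂) := by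
  apply ContinuousMulEquiv.ext
  intro y
  obtain ⟨x, rfl⟩ := Sα.admissible_surjective y
  rw [descend_admissible, ContinuousMulEquiv.trans_apply, ContinuousMulEquiv.trans_apply,
    descend_admissible, descend_admissible]

omit [Field Kγ] in
/-- **`descend γ⁻¹ = (descend γ)⁻¹`.** [cite: MochizukiSemiAnbd2006, Cor 3.11 p.46] -/
theorem descend_symm {γ : Dα.delta ≃ₜ* Dβ.delta} (h : Sα.KernelCompatible Sβ γ) :
    (Sα.descend Sβ γ h).symm = Sβ.descend Sα γ.symm h.symm := by
  apply ContinuousMulEquiv.ext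
  intro y
  obtain ⟨x, rfl⟩ := Sβ.admissible_surjective y
  rw [descend_admissible]
  apply (Sα.descend Sβ γ h).injective
  rw [ContinuousMulEquiv.apply_symm_apply, descend_admissible, ContinuousMulEquiv.apply_symm_apply]

omit [Field Kγ] in
/-- The descended isomorphism does not depend on the kernel-compatibility witness and is determined by
`γ` (proof irrelevance made explicit for rewriting). [cite: MochizukiSemiAnbd2006, Cor 3.11 p.46] -/
theorem descend_congr {γ γ' : Dα.delta ≃ₜ* Dβ.delta} (h : Sα.KernelCompatible Sβ γ)
    (h' : Sα.KernelCompatible Sβ γ') (hγ : γ = γ') : Sα.descend Sβ γ h = Sα.descend Sβ γ' h' := by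
  subst hγ; rfl

/-! ### Consistency with the conjugation automorphisms of `TemperedSpecialFibreDataVertexAction.lean` -/

/-- Under (P0)₀ (the admissible kernel is normal in `Π`), the inner automorphism `conjDelta g` of `Δ`
(`g ∈ Π`) is kernel compatible. [cite: MochizukiSemiAnbd2006, Ex 3.10 p.44] -/
theorem kernelCompatible_conjDelta {K : Type u} [Field K] {D : TemperedArithmeticGroup K}
    (S : SpecialFibreData D) (hK0 : (S.admissible.toMonoidHom.ker.map D.delta.subtype).Normal) (g : D.Pi) :
    S.KernelCompatible S (conjDelta g) := by
  intro x
  constructor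
  · intro hx
    exact S.conjDelta_mem_ker hK0 g hx
  · intro hx
    have h' := S.conjDelta_mem_ker hK0 g⁻¹ hx
    rwa [← conjDelta_mul, inv_mul_cancel, conjDelta_one] at h'

/-- **`autOfConj g` IS the descent of `conjDelta g`**: the automorphism of `π₁^temp(G^c)` induced by
conjugation by `g ∈ Π` (`SpecialFibreData.autOfConj`) coincides with `descend` applied to the inner
automorphism of `Δ` — the two constructions agree. [cite: MochizukiSemiAnbd2006, Ex 3.10 p.44] -/
theorem descend_conjDelta_eq_autOfConj {K : Type u} [Field K] {D : TemperedArithmeticGroup K}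
    (S : SpecialFibreData D) (hK0 : (S.admissible.toMonoidHom.ker.map D.delta.subtype).Normal) (g : D.Pi) :
    S.descend S (conjDelta g) (S.kernelCompatible_conjDelta hK0 g) = S.autOfConj hK0 g := by
  apply ContinuousMulEquiv.ext
  intro y
  obtain ⟨x, rfl⟩ := S.admissible_surjective y
  rw [descend_admissible, autOfConj_admissible]

end SpecialFibreData

/-! ### Functoriality at the origin hypotheses -/

section Cor311

variable {Kα : Type u} [Field Kα] {Kβ : Type u} [Field Kβ] {Kγ : Type u} [Field Kγ]

/-- **(S1a) ⇒ the descent is a functor in `γ`** ([SemiAnbd] Cor. 3.11 p. 46 "functorial with respect to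
`γ`"): for certified special-fibre data on three curves and `γ₁ : Δ[α] ⥲ Δ[β]`, `γ₂ : Δ[β] ⥲ Δ[γ]`, the
isomorphism of the tempered fundamental groups of the special fibres descended from `γ₁ ≫ γ₂` is the
composite of the ones descended from `γ₁` and `γ₂`. [cite: MochizukiSemiAnbd2006, Cor 3.11 p.46] -/
theorem descend_functorial_of_admissibleKernelCompatible
    {Ωα : SpecialFibreOrigin Kα} {Ωβ : SpecialFibreOrigin Kβ} {Ωγ : SpecialFibreOrigin Kγ}
    (hαβ : AdmissibleKernelCompatible Ωα Ωβ) (hβγ : AdmissibleKernelCompatible Ωβ Ωγ)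
    (hαγ : AdmissibleKernelCompatible Ωα Ωγ)
    {Dα : TemperedArithmeticGroup Kα} {Dβ : TemperedArithmeticGroup Kβ} {Dγ : TemperedArithmeticGroup Kγ}
    {Sα : SpecialFibreData Dα} {Sβ : SpecialFibreData Dβ} {Sγ : SpecialFibreData Dγ}
    (hα : Ωα.IsSpecialFibreOf Dα Sα) (hβ : Ωβ.IsSpecialFibreOf Dβ Sβ) (hγ : Ωγ.IsSpecialFibreOf Dγ Sγ)
    (γ₁ : Dα.delta ≃ₜ* Dβ.delta) (γ₂ : Dβ.delta ≃ₜ* Dγ.delta) :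
    Sα.descend Sγ (γ₁.trans γ₂) (hαγ Dα Dγ Sα Sγ hα hγ _) =
      (Sα.descend Sβ γ₁ (hαβ Dα Dβ Sα Sβ hα hβ γ₁)).trans (Sβ.descend Sγ γ₂ (hβγ Dβ Dγ Sβ Sγ hβ hγ γ₂)) := by
  rw [← SpecialFibreData.descend_trans]

end Cor311

end Literature.AnabelianGeometry.SemiGraphs

end
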